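import Literature.AlgebraicGeometry.Frobenioids.ModelFrobenioidBirational
import Literature.AnabelianGeometry.EtaleTheta.BiKummer

/-!
# [EtTh] §4 merge adapter: the birational data of the bi-Kummer setting from the model Frobenioid

Mochizuki, *The étale theta function and its Frobenioid-theoretic manifestations*, Publ. RIMS **45**
(2009), §4 p. 312 (PDF p. 86) [cite: MochizukiEtTh2009, Def 4.1 p.86]: "Recall that pre-steps of `C`
map to isomorphisms in `C^birat` [cf. [FrdI], Proposition 4.4, (iv)]. In particular, … any
base-equivalent pair of pre-steps `s', s'' : A → B` in `C` determines, by inverting the image of `s''`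
in `C^birat`, an element '`s' · (s'')⁻¹`' `∈ O^×(A^birat)`."  abc-iut cell, layer L2, unit W2-L2-05
(merge adapter t3/found/L1 → t4), seat abc-iut-L2-t9.

abc-iut-L2-t3's §4 setting `BiKummerSetting X T D VD` (`BiKummer.lean`) is typed over the REAL
category `C = tf.category` of the tempered Frobenioid (`TemperedFrobenioidModel.lean` = the tree's
`Frobenioids.ModelFrobenioid`, [FrdI] Thm. 5.2), but carries the BIRATIONAL vocabulary of [FrdI]
Prop. 4.4 as hypothesis fields (`biratUnits`, `biratAut`, `restrictAlong`, `fracOf`,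
`TODO-merge(abc-iut-L1-t3)`) because the birationalization `C^birat` is not in the tree.  For the model
Frobenioid these are explicit by [FrdI] Thm. 5.2 (ii) ("`O^×(−)` on `C^birat` is `B`", tree:
`ModelFrobenioidUnits.lean`, `ModelFrobenioidBirational.lean`).  This file supplies them:

* `TemperedFrobenioid.isUnit_ratFn` — `B(A) = B₀^Λ ×_{(Φ^{ℝ-log})^gp} Φ^gp` is group-like when `B₀^Λ` is
  (hypothesis `hBΛ`; in print `B₀^Λ ∈ {B₀, B₀^pf, ℝ·Φ₀^birat}` is a group, Def. 3.6 (i));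
* `biratUnitsModel A := B(A_D)^×` (`O^×(A^birat)`), `biratAutModel` (the action of `Aut_C(A)` through
  `Aut_D(A_D)`), `restrictAlongModel` ("`f ↦ f|_B`" along a pre-step), `fracOfModel` (`s' · (s'')⁻¹ :=
  u_{s'} · u_{s''}⁻¹`), `pullFracModel` (the `((α')^birat)^*` of Prop. 4.2 (iii));
* `BiKummerSetting.mkOfModel` — the §4 setting with these five fields FILLED; the remaining inputs are
  its arguments: disjoint supports ([FrdI] Prop. 4.1 (iii); `TODO-merge(abc-iut-L1-t3)`), Galois objects
  and `Π^tp_X ↠ Aut_D(A^bs)` ([SemiAnbd], `TODO-merge(abc-iut-L3-t2)`), `(N, H)`-saturation ([FrdII]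
  Def. 2.2 (ii), `TODO-merge(abc-iut-L1-t4)`), "arise from a base-Frobenius pair" ([FrdI] Def. 2.7 (iii),
  `TODO-merge(abc-iut-L1-t2)`), the object `A_⊙`;
* the dictionary: `Div_B(s' · (s'')⁻¹) = Div(s') − Div(s'')` (`divB_fracOfModel` — Def. 4.1 (i)'s
  "zero divisor" / "divisor of poles" of a fraction-pair), `O^×(A)` acts trivially on `O^×(A^birat)`
  (`biratAutModel_eq_one_of_mem_units`), pull-back along a pre-step undoes restriction
  (`pullFracModel_restrictAlongModel`); the fields of `mkOfModel` are these definitions (`mkOfModel_fracOf`).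

Multiplicative notation; diagrammatic composition.  HONEST FRAMING: a construction over abc-iut-L2-t3's
DATA; nothing asserts such data exist for an actual curve; no statement of §4 is proved here.
-/

noncomputable section

namespace Literature.AnabelianGeometry.EtaleTheta

open CategoryTheory Opposite Literature.AlgebraicGeometry.Frobenioids

universe u₀ v₀ u v w

/-- Functoriality of `M ↦ M^×` on automorphisms: `Aut(M) → Aut(M^×)`, `e ↦ e|_{M^×}` (used to let
`Aut_C(A)` act on the unit group `B(A_D)^× = O^×(A^birat)`). [cite: MochizukiFrdI2008, Thm. 5.2(ii) p.101] -/
def unitsAutHom (M : Type w) [Monoid M] : MulAut M →* MulAut Mˣ where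
  toFun e := Units.mapEquiv e
  map_one' := MulEquiv.ext fun _ => Units.ext rfl
  map_mul' _ _ := MulEquiv.ext fun _ => Units.ext rfl

/-- `unitsAutHom` on elements. [cite: MochizukiFrdI2008, Thm. 5.2(ii) p.101] -/
@[simp] theorem coe_unitsAutHom_apply {M : Type w} [Monoid M] (e : MulAut M) (u : Mˣ) :
    ((unitsAutHom M e u : Mˣ) : M) = e u := rfl

namespace TemperedFrobenioid

variable {D₀ : Type u₀} [Category.{v₀} D₀] {V : FrdIMonoidStub.{w}}
  {T : RealifiedDivisorMonoids (D₀ := D₀) V} {D : Type u} [Category.{v} D]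
  {VD : FrdICatStub.{u, v, w} D} (C : TemperedFrobenioid T D VD)

/-! ### `B(A)` is group-like -/

/-- If every element of `B₀^Λ(Base A)` is invertible (as it is in print: `B₀^Λ ∈ {B₀, B₀^pf, ℝ·Φ₀^birat}`,
Def. 3.6 (i); cf. `DivisorMonoids.isUnit_B₀`), then so is every element of
`B(A) = B₀^Λ(Base A) ×_{(Φ^{ℝ-log})^gp(A)} Φ(A)^gp`: the inverse of `(b, ξ)` is `(b⁻¹, ξ⁻¹)`.
[cite: MochizukiEtTh2009, Def 3.6 p.303 (PDF p.77)] -/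
theorem isUnit_ratFn {A : Dᵒᵖ} (h : ∀ b : T.BΛ.obj (C.baseOp A), IsUnit b) (p : C.ratFn A) :
    IsUnit p := by
  obtain ⟨ub, hub⟩ := h p.1.1
  have hmem : ((↑ub⁻¹ : T.BΛ.obj (C.baseOp A)), p.1.2⁻¹) ∈ C.ratFn A := by
    change T.divΛ (C.baseOp A) (↑ub⁻¹) = C.ΦgpToRlog A p.1.2⁻¹
    have hp : T.divΛ (C.baseOp A) p.1.1 = C.ΦgpToRlog A p.1.2 := p.2
    rw [map_units_inv, hub, hp, map_inv]
  refine IsUnit.of_mul_eq_one ⟨_, hmem⟩ (Subtype.ext (Prod.ext ?_ ?_))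
  · change p.1.1 * ↑ub⁻¹ = 1
    rw [← hub, Units.mul_inv]
  · change p.1.2 * p.1.2⁻¹ = 1
    rw [mul_inv_cancel]

/-- `B(A_D)` is group-like for every object `A = (A_D, α)` of the tempered Frobenioid, given that `B₀^Λ`
is. [cite: MochizukiEtTh2009, Def 3.6 p.303 (PDF p.77)] -/
theorem isUnit_ratFnFunctor (hBΛ : ∀ (Y : D₀ᵒᵖ) (b : T.BΛ.obj Y), IsUnit b) (A : C.category)
    (b : C.ratFnFunctor.obj (op A.base)) : IsUnit b :=
  C.isUnit_ratFn (hBΛ _) b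

/-! ### The birational vocabulary of §4 for the model -/

/-- `O^×(A^birat) := B(A_D)^×` for an object `A` of the tempered Frobenioid ([FrdI] Thm. 5.2 (ii):
"`O^×(−)` on `C^birat` is `B`"). [cite: MochizukiEtTh2009, Def 4.1 p.312 (PDF p.86)] -/
abbrev biratUnitsModel (A : C.category) : Type w := (C.ratFnFunctor.obj (op A.base))ˣ

/-- "the natural action" of `Aut_C(A)` on `O^×(A^birat) = B(A_D)^×` (Def. 4.1 (iii)): through
`Aut_C(A) → Aut_D(A_D)` and the functoriality of `B` (`ModelFrobenioid.biratAct`), restricted to units.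
[cite: MochizukiEtTh2009, Def 4.1 p.313 (PDF p.87)] -/
def biratAutModel (A : C.category) : Aut A →* MulAut (C.biratUnitsModel A) :=
  (unitsAutHom _).comp (ModelFrobenioid.biratAct A)

/-- `biratAutModel` on elements: `σ · f = B(Base(σ⁻¹))(f)`. [cite: MochizukiEtTh2009, Def 4.1 p.313 (PDF p.87)] -/
@[simp] theorem coe_biratAutModel_apply (A : C.category) (σ : Aut A) (f : C.biratUnitsModel A) :
    ((C.biratAutModel A σ f : C.biratUnitsModel A) : C.ratFnFunctor.obj (op A.base)) =
      (C.ratFnFunctor.map (ModelFrobenioid.baseMap σ.inv).op).hom f := rfl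

/-- "pre-steps of `C` map to isomorphisms in `C^birat` [cf. [FrdI], Proposition 4.4, (iv)]", `f ↦ f|_B`:
`O^×(A^birat) ⥲ O^×(B^birat)` along a pre-step `s : A → B` — on `B(−)`, transport along `Base(s)⁻¹`
(`ModelFrobenioid.biratRestrict`). [cite: MochizukiEtTh2009, Def 4.1 p.312 (PDF p.86)] -/
def restrictAlongModel {A B : C.category} (s : A ⟶ B) (hs : PreFrobenioid.IsPreStep C.toElem s) :
    C.biratUnitsModel A ≃* C.biratUnitsModel B :=
  haveI : IsIso (ModelFrobenioid.baseMap s) := hs.2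
  Units.mapEquiv (ModelFrobenioid.biratRestrict s)

/-- `restrictAlongModel` on elements: `f|_B = B(Base(s)⁻¹)(f)`. [cite: MochizukiEtTh2009, Def 4.1 p.312 (PDF p.86)] -/
theorem coe_restrictAlongModel_apply {A B : C.category} (s : A ⟶ B)
    (hs : PreFrobenioid.IsPreStep C.toElem s) (f : C.biratUnitsModel A) :
    ((C.restrictAlongModel s hs f : C.biratUnitsModel B) : C.ratFnFunctor.obj (op B.base)) =
      haveI : IsIso (ModelFrobenioid.baseMap s) := hs.2
      (C.ratFnFunctor.map (inv (ModelFrobenioid.baseMap s)).op).hom f := rfl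

/-- The fraction "`s' · (s'')⁻¹`" `∈ O^×(A^birat)` of a pair `s', s'' : A → B` (§4 p.312 (PDF p.86)): in
the model, `u_{s'} · u_{s''}⁻¹ ∈ B(A_D)^×` (`ModelFrobenioid.frac`; `B` group-like by `hBΛ`).
[cite: MochizukiEtTh2009, Def 4.1 p.312 (PDF p.86)] -/
def fracOfModel (hBΛ : ∀ (Y : D₀ᵒᵖ) (b : T.BΛ.obj Y), IsUnit b) {A B : C.category} (s' s'' : A ⟶ B) :
    C.biratUnitsModel A :=
  ModelFrobenioid.frac (C.isUnit_ratFnFunctor hBΛ A) s' s''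

/-- Pull-back of birational units along an arbitrary morphism `φ : A' → A`: `B(Base φ)` on units (the
`((α')^birat)^*` of Prop. 4.2 (iii), the `pullFrac` parameter of abc-iut-L2-t3's `BiKummerRoots.lean`).
[cite: MochizukiEtTh2009, Prop 4.2 p.314 (PDF p.88)] -/
def pullFracModel {A A' : C.category} (φ : A' ⟶ A) : C.biratUnitsModel A →* C.biratUnitsModel A' :=
  Units.map (C.ratFnFunctor.map (ModelFrobenioid.baseMap φ).op).hom

/-- `pullFracModel` on elements. [cite: MochizukiEtTh2009, Prop 4.2 p.314 (PDF p.88)] -/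
@[simp] theorem coe_pullFracModel_apply {A A' : C.category} (φ : A' ⟶ A) (f : C.biratUnitsModel A) :
    ((C.pullFracModel φ f : C.biratUnitsModel A') : C.ratFnFunctor.obj (op A'.base)) =
      (C.ratFnFunctor.map (ModelFrobenioid.baseMap φ).op).hom f := rfl

/-! ### Dictionary for the model-level birational vocabulary -/

/-- The fraction of a pair is `u_{s'} · u_{s''}⁻¹` in `B(A_D)`. [cite: MochizukiEtTh2009, Def 4.1 p.312 (PDF p.86)] -/
theorem coe_fracOfModel (hBΛ : ∀ (Y : D₀ᵒᵖ) (b : T.BΛ.obj Y), IsUnit b) {A B : C.category}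
    (s' s'' : A ⟶ B) :
    ((C.fracOfModel hBΛ s' s'' : C.biratUnitsModel A) : C.ratFnFunctor.obj (op A.base)) =
      ModelFrobenioid.unit s' * ↑(C.isUnit_ratFnFunctor hBΛ A (ModelFrobenioid.unit s'')).unit⁻¹ := by
  rw [fracOfModel, ModelFrobenioid.frac, div_eq_mul_inv, Units.val_mul]
  rfl

/-- **Definition 4.1 (i) for the model: the divisor of a fraction-pair.**  For a base-equivalent pair
of pre-steps `s', s''`, `Div_B(s' · (s'')⁻¹) = Div(s') − Div(s'')` in `Φ(A_D)^gp` — the "zero divisor"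
`Div(s')` and the "divisor of poles" `Div(s'')` of the fraction-pair (p.313 (PDF p.87)); from
`ModelFrobenioid.divB_frac`. [cite: MochizukiEtTh2009, Def 4.1 p.313 (PDF p.87)] -/
theorem divB_fracOfModel (hBΛ : ∀ (Y : D₀ᵒᵖ) (b : T.BΛ.obj Y), IsUnit b) {A B : C.category}
    (s' s'' : A ⟶ B) (h' : PreFrobenioid.IsPreStep C.toElem s') (h'' : PreFrobenioid.IsPreStep C.toElem s'')
    (hb : PreFrobenioid.BaseEquivalent C.toElem s' s'') :
    Literature.AlgebraicGeometry.Frobenioids.divB C.divisorMonoid C.ratFnFunctor C.divBNatTrans (op A.base)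
        (C.fracOfModel hBΛ s' s'' : C.ratFnFunctor.obj (op A.base)) =
      Algebra.GrothendieckGroup.of (ModelFrobenioid.div s') /
        Algebra.GrothendieckGroup.of (ModelFrobenioid.div s'') := by
  have hd : ModelFrobenioid.degFr s' = ModelFrobenioid.degFr s'' := h'.1.trans h''.1.symm
  exact ModelFrobenioid.divB_frac (C.isUnit_ratFnFunctor hBΛ A) s' s'' hb hd

/-- `O^×(A)` acts trivially on `O^×(A^birat)`: the action of Def. 4.1 (ii)–(iii) factors through
`Aut_C(A)/O^×(A) ↪ Aut_D(A^bs)`. [cite: MochizukiEtTh2009, Def 4.1 p.313 (PDF p.87)] -/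
theorem biratAutModel_eq_one_of_mem_units {A : C.category} {σ : Aut A}
    (hσ : σ ∈ ModelFrobenioid.units A) : C.biratAutModel A σ = 1 := by
  rw [biratAutModel, MonoidHom.comp_apply, ModelFrobenioid.baseAct_eq_one_of_mem_units _ _ hσ, map_one]

/-- Restriction along a pre-step is transport along `Base(s)⁻¹`, and pull-back along `s` undoes it:
`B(Base s)(f|_B) = f`. [cite: MochizukiEtTh2009, Def 4.1 p.312 (PDF p.86)] -/
theorem pullFracModel_restrictAlongModel {A B : C.category} (s : A ⟶ B)
    (hs : PreFrobenioid.IsPreStep C.toElem s) (f : C.biratUnitsModel A) :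
    C.pullFracModel s (C.restrictAlongModel s hs f) = f := by
  haveI : IsIso (ModelFrobenioid.baseMap s) := hs.2
  apply Units.ext
  exact (ModelFrobenioid.biratRestrict s).symm_apply_apply (f : C.ratFnFunctor.obj (op A.base))

end TemperedFrobenioid

namespace BiKummerSetting

variable {K : Type u₀} [Field K] (X : SemiGraphs.TemperedArithmeticGroup.{u₀} K) {D₀ : Type u₀} [Category.{v₀} D₀]
  {V : FrdIMonoidStub.{w}} {T : RealifiedDivisorMonoids (D₀ := D₀) V} {D : Type u} [Category.{v} D]
  {VD : FrdICatStub.{u, v, w} D}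

/-- **The §4 setting with its birational vocabulary FILLED from the model** ([FrdI] Thm. 5.2 (ii)):
`O^×(A^birat) := B(A_D)^×`, the `Aut_C(A)`-action through `Aut_D(A_D)`, restriction along pre-steps by
transport along `Base(s)⁻¹`, `s' · (s'')⁻¹ := u_{s'} · u_{s''}⁻¹`.  Arguments = the inputs that remain
primitive: `tf`, its monoid type and perfection, `hBΛ` (`B₀^Λ` group-like), disjoint supports
(`TODO-merge(abc-iut-L1-t3)`), Galois objects / `Π^tp_X ↠ Aut_D(−)` (`TODO-merge(abc-iut-L3-t2)`),
`(N, H)`-saturation (`TODO-merge(abc-iut-L1-t4)`), base-Frobenius pairs (`TODO-merge(abc-iut-L1-t2)`),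
and `A_⊙`. [cite: MochizukiEtTh2009, Def 4.1 p.312 (PDF p.86)] -/
def mkOfModel (tf : TemperedFrobenioid T D VD) (monoidType_eq : tf.monoidType = MonoidType.Z)
    (isPerfect : ∀ A : Dᵒᵖ, IsPerfect (tf.Φ.carrier A))
    (hBΛ : ∀ (Y : D₀ᵒᵖ) (b : T.BΛ.obj Y), IsUnit b)
    (DisjointSupports : ∀ {A : Dᵒᵖ}, tf.Φ.carrier A → tf.Φ.carrier A → Prop)
    (IsGaloisObj : D → Prop) (galoisSurj : ∀ A : D, IsGaloisObj A → (X.Pi →* Aut A))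
    (galoisSurj_surjective : ∀ (A : D) (h : IsGaloisObj A), Function.Surjective (galoisSurj A h))
    (IsNHSaturatedBsFld : Subgroup (Field.absoluteGaloisGroup K) → tf.category → ℕ+ → Prop)
    (ArisesFromBaseFrobeniusPair : ∀ {A B : tf.category}, Subgroup (Aut A) → (A ⟶ A) → (A ⟶ B) → Prop)
    (Aodot : tf.category) (isFrobeniusTrivial_Aodot : PreFrobenioid.IsFrobeniusTrivial tf.toElem Aodot)
    (isGalois_Aodot : IsGaloisObj Aodot.base) : BiKummerSetting X T D VD where
  tf := tf
  monoidType_eq := monoidType_eq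
  isPerfect := isPerfect
  DisjointSupports := DisjointSupports
  biratUnits := tf.biratUnitsModel
  biratAut := tf.biratAutModel
  restrictAlong s hs := tf.restrictAlongModel s hs
  fracOf s' s'' _ _ _ := tf.fracOfModel hBΛ s' s''
  IsGaloisObj := IsGaloisObj
  galoisSurj := galoisSurj
  galoisSurj_surjective := galoisSurj_surjective
  IsNHSaturatedBsFld := IsNHSaturatedBsFld
  ArisesFromBaseFrobeniusPair := ArisesFromBaseFrobeniusPair
  Aodot := Aodot
  isFrobeniusTrivial_Aodot := isFrobeniusTrivial_Aodot
  isGalois_Aodot := isGalois_Aodot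

/-- The birational fields of `mkOfModel` are the model-level definitions (`biratUnitsModel`,
`biratAutModel`, `restrictAlongModel`, `fracOfModel`) — definitionally; e.g. the fraction.
[cite: MochizukiEtTh2009, Def 4.1 p.312 (PDF p.86)] -/
theorem mkOfModel_fracOf (tf : TemperedFrobenioid T D VD) (hZ : tf.monoidType = MonoidType.Z)
    (hP : ∀ A : Dᵒᵖ, IsPerfect (tf.Φ.carrier A)) (hBΛ : ∀ (Y : D₀ᵒᵖ) (b : T.BΛ.obj Y), IsUnit b)
    (DS : ∀ {A : Dᵒᵖ}, tf.Φ.carrier A → tf.Φ.carrier A → Prop) (IG : D → Prop)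
    (gS : ∀ A : D, IG A → (X.Pi →* Aut A)) (gSs : ∀ (A : D) (h : IG A), Function.Surjective (gS A h))
    (NH : Subgroup (Field.absoluteGaloisGroup K) → tf.category → ℕ+ → Prop)
    (AB : ∀ {A B : tf.category}, Subgroup (Aut A) → (A ⟶ A) → (A ⟶ B) → Prop) (A₀ : tf.category)
    (hA₀ : PreFrobenioid.IsFrobeniusTrivial tf.toElem A₀) (hA₀' : IG A₀.base) {A B : tf.category}
    (s' s'' : A ⟶ B) (h' : PreFrobenioid.IsPreStep tf.toElem s')
    (h'' : PreFrobenioid.IsPreStep tf.toElem s'') (hb : PreFrobenioid.BaseEquivalent tf.toElem s' s'') :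
    (mkOfModel X tf hZ hP hBΛ DS IG gS gSs NH AB A₀ hA₀ hA₀').fracOf s' s'' h' h'' hb =
      tf.fracOfModel hBΛ s' s'' := rfl

end BiKummerSetting

end Literature.AnabelianGeometry.EtaleTheta
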